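import Literature.NumberTheory.ComplexMultiplication.MainTheoremCMLevelPrime
import Literature.NumberTheory.ComplexMultiplication.MainTheoremCMLevelData
import HarnessLib

/-!
# The main theorem of complex multiplication — the `ℓ`-adic reduction block for GIVEN (produced) reduction data
# (S7a piece G8, `_of_data` variants) [Shimura 1998, §18.6 proof of Thm. 18.6, p. 129; §11.1 Prop. 12, Prop. 14 (i)]

Topic `Literature/NumberTheory/ComplexMultiplication`, namespace `Literature.NumberTheory.ComplexMultiplication`.
THEOREMS ONLY (no definition, no named fact, no instance; net Literature debt **0**).  Cell `hodgecm-mathlib` (D-0151), fan B-II,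
line `b2_main_theorem_cm` (crux item stmt-HodgeConjecture-24834, row II-1 `shimura1998_thm18_6`), stub S7a «level structure»
(`levelStructure`; S7a pen B-p15, harness `S7aHarness.core`).  Companion of `MainTheoremCMLevelData.lean` (p607958) and
`MainTheoremCMLevelPrimeData.lean` (p608921), written to the S7a slot table of 2026-08-28T06:16:11Z (§9–§12 «the `_of_data` VARIANT
taking `R₀`, `Rᵢ` as GIVEN») and director g2 BATCH 30–31 (single reduction binder `FactRH′` = B-p07's THEOREM
`exists_finite_forall_exists_goodReductionAt_homReduction`, p609107: good-reduction data AND in-family pair data are PRODUCED, not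
chosen; «A-p01's `_of_data` variant takes R AND all six H GIVEN, choosing nothing, supplying only the ∀ℓ T-block via hS5c»):

* `exists_levelTateData_pair_of_data` — EVERYTHING given (`R`, `Rᵢ`, the six pair data): from F-S5c alone, for each prime `ℓ ∤ v`,
  `T0`, `Ti`, `Tγ`, the six Tate compatibilities, `σ̃`, (σ-a), (σ-b), one common prime, (2′) — in G10's binder names;
* `exists_levelReductionData_pair_of_homReduction` — `R`, `Rᵢ`, `H0i`, `Hi0` given (the produced data), the four conjFrob companions
  chosen once via F-HR, then the `ℓ`-adic block for every `ℓ ∤ v`;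
* `exists_levelReductionData_pair_of_goodReductionAt` — `R`, `Rᵢ` given, all six pair data chosen once via F-HR (the slot table's ask);
* `exists_frobeniusPrime_levelReductionData_of_produced` — Shimura's prime `𝔓` (G5, Čebotarev, outside `S ∪ S_RH`) together with the
  PRODUCED data of `FactRH′` at `𝔓`, the conjFrob companions via F-HR, and the F-S5c block at every `ℓ ∤ 𝔓`: hypotheses
  {`FactRH′` (a THEOREM, B-p07), F-HR (only at the conjFrob pairs), F-S5c}; FactGR is gone.

HC_CM is proved only modulo the 7 printed citations until rung 0 closes; this file adds no hypothesis beyond the line's own binders.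

## References
* [Shimura1998] G. Shimura, *Abelian Varieties with Complex Multiplication and Modular Functions*, Princeton Univ. Press (1998):
  §18.6 proof of Thm. 18.6, pp. 128–129; §11.1 Prop. 12, Prop. 14 (i).
* [BombieriGubler2006] E. Bombieri, W. Gubler, *Heights in Diophantine Geometry* (2006), 10.3.9 (Néron model).
-/

set_option autoImplicit false

open NumberField IsDedekindDomain
open Literature.AlgebraicGeometry.Motives Literature.AlgebraicGeometry.Motives.AbelianVariety
open Literature.AlgebraicGeometry.Motives.AbelianVariety.GoodReductionAt
open Literature.NumberTheory.GaloisRepresentations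

namespace Literature.NumberTheory.ComplexMultiplication

/-! ## The `ℓ`-adic block for given data -/

/-- **G8 `_of_data` (everything GIVEN): the `ℓ`-adic block alone.**  For two `L`-varieties `A₀`, `Aᵢ`, an arithmetic Frobenius `γ`
at `v` (`q = pⁿ`), GIVEN good-reduction data `R`, `Rᵢ` and GIVEN pair data `H0i`, `Hi0`, `Hiγ`, `Hγi`, `H0γ`, `Hγ0` (towards the
constructed `R.conjFrob γ hγ p n hq`), and a prime `ℓ` with `v ∤ ℓ`: from F-S5c AS HYPOTHESIS (`hS5c`, the line's `FactS5c` verbatim)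
alone, the specialisations `T0`, `Ti`, `Tγ` with the six Tate compatibilities, `σ̃ ∈ Aut(L̄)` over `γ` with (σ-b), one common prime,
and the geometric torsion clause (2′) on `A₀[ℓᵐ](L̄)` — F-S5c applied to the two-member family `Bool → {A₀, Aᵢ}` (`false ↦ A₀`) with
diagonal pair data `HomReduction.ofEnd`.  Nothing is chosen.  [cite: Shimura1998, §11.1 Prop. 14 (i); §18.6 proof of Thm. 18.6, p. 129] -/
theorem exists_levelTateData_pair_of_data
    (hS5c : ∀ {F₀ k : Type} [Field F₀] [NumberField F₀] [Field k] [NumberField k] [Algebra F₀ k]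
      {v : HeightOneSpectrum (𝓞 k)} {ι : Type} {A : ι → AbelianVariety k}
      (R : ∀ i, (A i).GoodReductionAt v) (H : ∀ i j, HomReduction (R i) (R j)) (a : ι)
      (γ : k ≃ₐ[F₀] k) (hγ : IsArithFrobAt (𝓞 F₀) γ v.asIdeal) (p n : ℕ) [ExpChar v.asIdeal.ResidueField p]
      (hq : Nat.card (𝓞 F₀ ⧸ v.asIdeal.under (𝓞 F₀)) = p ^ n)
      (Hγ : ∀ i, HomReduction (R i) ((R a).conjFrob γ hγ p n hq))
      (Hγ' : ∀ i, HomReduction ((R a).conjFrob γ hγ p n hq) (R i)) (ℓ : ℕ) [Fact ℓ.Prime],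
      HomReduction.exists_isTateCompatible_family_conjFrob R H a γ hγ p n hq Hγ Hγ' ℓ)
    {F₀ L : Type} [Field F₀] [NumberField F₀] [Field L] [NumberField L] [Algebra F₀ L]
    {A₀ Aᵢ : AbelianVariety L} {v : HeightOneSpectrum (𝓞 L)}
    (γ : L ≃ₐ[F₀] L) (hγ : IsArithFrobAt (𝓞 F₀) γ v.asIdeal) (p n : ℕ) [ExpChar v.asIdeal.ResidueField p]
    (hq : Nat.card (𝓞 F₀ ⧸ v.asIdeal.under (𝓞 F₀)) = p ^ n)
    (R : A₀.GoodReductionAt v) (Rᵢ : Aᵢ.GoodReductionAt v)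
    (H0i : HomReduction R Rᵢ) (Hi0 : HomReduction Rᵢ R)
    (Hiγ : HomReduction Rᵢ (R.conjFrob γ hγ p n hq)) (Hγi : HomReduction (R.conjFrob γ hγ p n hq) Rᵢ)
    (H0γ : HomReduction R (R.conjFrob γ hγ p n hq)) (Hγ0 : HomReduction (R.conjFrob γ hγ p n hq) R)
    {ℓ : ℕ} [Fact ℓ.Prime] (hℓv : (ℓ : 𝓞 L) ∉ v.asIdeal) :
    ∃ (T0 : R.TateSpecialisation ℓ) (Ti : Rᵢ.TateSpecialisation ℓ) (Tγ : (R.conjFrob γ hγ p n hq).TateSpecialisation ℓ)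
        (_h0i : H0i.IsTateCompatible T0 Ti) (_hi0 : Hi0.IsTateCompatible Ti T0)
        (_hiγT : Hiγ.IsTateCompatible Ti Tγ) (_hγiT : Hγi.IsTateCompatible Tγ Ti)
        (_h0γ : H0γ.IsTateCompatible T0 Tγ) (_hγ0 : Hγ0.IsTateCompatible Tγ T0)
        (σ' : AlgebraicClosure L ≃+* AlgebraicClosure L)
        -- (σ-a) `σ̃` extends `γ`
        (hσa : ∀ x : L, σ' (algebraMap L (AlgebraicClosure L) x) = algebraMap L (AlgebraicClosure L) (γ.toRingEquiv x)),
        -- (σ-b) `σ̃` is the `q`-th power map on the `ℓ`-power roots of unity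
        (∀ (m : ℕ) (ζ : AlgebraicClosure L), ζ ^ (ℓ ^ m) = 1 → σ' ζ = ζ ^ (p ^ n)) ∧
        -- one common prime
        T0.prime = Ti.prime ∧ Tγ.prime = T0.prime ∧
        -- (2′) the GEOMETRIC torsion clause «(x^σ̃)~ = π(x̃)» on A₀[ℓᵐ](K̄), the conjugate point read through (A^γ) ⊗ K̄ ≅ (A ⊗ K̄)^σ̃
        (∀ (m : ℕ) (x : A₀.geomTorsion (ℓ ^ m : ℕ)) (x' : (A₀.conjugate γ.toRingEquiv).geomTorsion (ℓ ^ m : ℕ)),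
          Additive.toMul (x' : (A₀.conjugate γ.toRingEquiv).geomPoints) =
            ((A₀.conjugate γ.toRingEquiv).pointsMulEquiv (AlgebraicClosure L)).symm
              (AlgPoints.map (conjugateBaseChangeAlongIso γ.toRingEquiv σ' hσa A₀).inv.hom.hom.hom
                ((A₀.baseChange (AlgebraicClosure L)).conjPoints σ'
                  (A₀.pointsMulEquiv (AlgebraicClosure L) (Additive.toMul (x : A₀.geomPoints))))) →
          (Tγ.reductionTorsionEquiv hℓv m x' : (R.conjFrob γ hγ p n hq).reduction.geomPoints) =
            Hom.geomPointsMap (R.reduction.relFrobenius p n)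
              (T0.reductionTorsionEquiv hℓv m x : R.reduction.geomPoints)) := by
  -- F-S5c on the two-member family `Bool → {A₀, Aᵢ}` (`false ↦ A₀`, `true ↦ Aᵢ`), diagonal pair data `ofEnd`
  let A' : Bool → AbelianVariety L := fun b => cond b Aᵢ A₀
  let R' : ∀ b, (A' b).GoodReductionAt v := fun b => Bool.rec (motive := fun b => (A' b).GoodReductionAt v) R Rᵢ b
  let H' : ∀ b c, HomReduction (R' b) (R' c) := fun b c =>
    Bool.rec (motive := fun b => HomReduction (R' b) (R' c))
      (Bool.rec (motive := fun c => HomReduction (R' false) (R' c)) (HomReduction.ofEnd R) H0i c)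
      (Bool.rec (motive := fun c => HomReduction (R' true) (R' c)) Hi0 (HomReduction.ofEnd Rᵢ) c) b
  let Hγf : ∀ b, HomReduction (R' b) ((R' false).conjFrob γ hγ p n hq) := fun b =>
    Bool.rec (motive := fun b => HomReduction (R' b) ((R' false).conjFrob γ hγ p n hq)) H0γ Hiγ b
  let Hγf' : ∀ b, HomReduction ((R' false).conjFrob γ hγ p n hq) (R' b) := fun b =>
    Bool.rec (motive := fun b => HomReduction ((R' false).conjFrob γ hγ p n hq) (R' b)) Hγ0 Hγi b
  obtain ⟨T, Tγ, σ', hσa, hσb, hTT, hTγ, hH, hHγ, hHγ', h2⟩ := hS5c R' H' false γ hγ p n hq Hγf Hγf' ℓ hℓv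
  exact ⟨T false, T true, Tγ, hH false true, hH true false, hHγ true, hHγ' true, hHγ false, hHγ' false, σ', hσa, hσb,
    hTT false true, hTγ false, h2⟩

/-- **G8 `_of_homReduction` (good-reduction data and the in-family pair data GIVEN — the PRODUCED data of `FactRH′` —, the four
conjFrob companions chosen via F-HR).**  From `hHR` (row II-1-Oa `nonempty_homReduction`, used ONLY at the four pairs involving the
constructed datum `R.conjFrob γ hγ p n hq`) and `hS5c`: given `R`, `Rᵢ`, `H0i`, `Hi0`, there are `Hiγ`, `Hγi`, `H0γ`, `Hγ0` — chosen ONCE —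
such that for every prime `ℓ ∤ v` the `ℓ`-adic block of `exists_levelTateData_pair_of_data` holds.
[cite: Shimura1998, §11.1 Prop. 12, Prop. 14 (i); §18.6 proof of Thm. 18.6, p. 129] -/
theorem exists_levelReductionData_pair_of_homReduction
    (hHR : ∀ {k : Type} [Field k] [NumberField k] {A₀ B₀ : AbelianVariety k} {v : HeightOneSpectrum (𝓞 k)}
      (R : A₀.GoodReductionAt v) (S : B₀.GoodReductionAt v), HomReduction.nonempty_homReduction R S)
    (hS5c : ∀ {F₀ k : Type} [Field F₀] [NumberField F₀] [Field k] [NumberField k] [Algebra F₀ k]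
      {v : HeightOneSpectrum (𝓞 k)} {ι : Type} {A : ι → AbelianVariety k}
      (R : ∀ i, (A i).GoodReductionAt v) (H : ∀ i j, HomReduction (R i) (R j)) (a : ι)
      (γ : k ≃ₐ[F₀] k) (hγ : IsArithFrobAt (𝓞 F₀) γ v.asIdeal) (p n : ℕ) [ExpChar v.asIdeal.ResidueField p]
      (hq : Nat.card (𝓞 F₀ ⧸ v.asIdeal.under (𝓞 F₀)) = p ^ n)
      (Hγ : ∀ i, HomReduction (R i) ((R a).conjFrob γ hγ p n hq))
      (Hγ' : ∀ i, HomReduction ((R a).conjFrob γ hγ p n hq) (R i)) (ℓ : ℕ) [Fact ℓ.Prime],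
      HomReduction.exists_isTateCompatible_family_conjFrob R H a γ hγ p n hq Hγ Hγ' ℓ)
    {F₀ L : Type} [Field F₀] [NumberField F₀] [Field L] [NumberField L] [Algebra F₀ L]
    {A₀ Aᵢ : AbelianVariety L} {v : HeightOneSpectrum (𝓞 L)}
    (γ : L ≃ₐ[F₀] L) (hγ : IsArithFrobAt (𝓞 F₀) γ v.asIdeal) (p n : ℕ) [ExpChar v.asIdeal.ResidueField p]
    (hq : Nat.card (𝓞 F₀ ⧸ v.asIdeal.under (𝓞 F₀)) = p ^ n)
    (R : A₀.GoodReductionAt v) (Rᵢ : Aᵢ.GoodReductionAt v)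
    (H0i : HomReduction R Rᵢ) (Hi0 : HomReduction Rᵢ R) :
    ∃ (Hiγ : HomReduction Rᵢ (R.conjFrob γ hγ p n hq)) (Hγi : HomReduction (R.conjFrob γ hγ p n hq) Rᵢ)
      (H0γ : HomReduction R (R.conjFrob γ hγ p n hq)) (Hγ0 : HomReduction (R.conjFrob γ hγ p n hq) R),
      ∀ (ℓ : ℕ) [Fact ℓ.Prime] (hℓv : (ℓ : 𝓞 L) ∉ v.asIdeal),
      ∃ (T0 : R.TateSpecialisation ℓ) (Ti : Rᵢ.TateSpecialisation ℓ) (Tγ : (R.conjFrob γ hγ p n hq).TateSpecialisation ℓ)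
        (_h0i : H0i.IsTateCompatible T0 Ti) (_hi0 : Hi0.IsTateCompatible Ti T0)
        (_hiγT : Hiγ.IsTateCompatible Ti Tγ) (_hγiT : Hγi.IsTateCompatible Tγ Ti)
        (_h0γ : H0γ.IsTateCompatible T0 Tγ) (_hγ0 : Hγ0.IsTateCompatible Tγ T0)
        (σ' : AlgebraicClosure L ≃+* AlgebraicClosure L)
        -- (σ-a) `σ̃` extends `γ`
        (hσa : ∀ x : L, σ' (algebraMap L (AlgebraicClosure L) x) = algebraMap L (AlgebraicClosure L) (γ.toRingEquiv x)),
        -- (σ-b) `σ̃` is the `q`-th power map on the `ℓ`-power roots of unity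
        (∀ (m : ℕ) (ζ : AlgebraicClosure L), ζ ^ (ℓ ^ m) = 1 → σ' ζ = ζ ^ (p ^ n)) ∧
        -- one common prime
        T0.prime = Ti.prime ∧ Tγ.prime = T0.prime ∧
        -- (2′) the GEOMETRIC torsion clause «(x^σ̃)~ = π(x̃)» on A₀[ℓᵐ](K̄), the conjugate point read through (A^γ) ⊗ K̄ ≅ (A ⊗ K̄)^σ̃
        (∀ (m : ℕ) (x : A₀.geomTorsion (ℓ ^ m : ℕ)) (x' : (A₀.conjugate γ.toRingEquiv).geomTorsion (ℓ ^ m : ℕ)),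
          Additive.toMul (x' : (A₀.conjugate γ.toRingEquiv).geomPoints) =
            ((A₀.conjugate γ.toRingEquiv).pointsMulEquiv (AlgebraicClosure L)).symm
              (AlgPoints.map (conjugateBaseChangeAlongIso γ.toRingEquiv σ' hσa A₀).inv.hom.hom.hom
                ((A₀.baseChange (AlgebraicClosure L)).conjPoints σ'
                  (A₀.pointsMulEquiv (AlgebraicClosure L) (Additive.toMul (x : A₀.geomPoints))))) →
          (Tγ.reductionTorsionEquiv hℓv m x' : (R.conjFrob γ hγ p n hq).reduction.geomPoints) =
            Hom.geomPointsMap (R.reduction.relFrobenius p n)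
              (T0.reductionTorsionEquiv hℓv m x : R.reduction.geomPoints)) := by
  classical
  exact ⟨Classical.choice (hHR Rᵢ (R.conjFrob γ hγ p n hq)), Classical.choice (hHR (R.conjFrob γ hγ p n hq) Rᵢ),
    Classical.choice (hHR R (R.conjFrob γ hγ p n hq)), Classical.choice (hHR (R.conjFrob γ hγ p n hq) R),
    fun ℓ _ hℓv => exists_levelTateData_pair_of_data hS5c γ hγ p n hq R Rᵢ H0i Hi0 _ _ _ _ hℓv⟩

/-- **G8 `_of_goodReductionAt` (good-reduction data GIVEN — e.g. from `FactGR′`'s `Nonempty (GoodReductionAt v)` at `v ∉ S` —, all six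
pair data chosen via F-HR; S7a slot table 2026-08-28T06:16:11Z §9–§12 ask).**  From `hHR` and `hS5c`: given `R`, `Rᵢ`, there are
`H0i`, `Hi0`, `Hiγ`, `Hγi`, `H0γ`, `Hγ0` — chosen ONCE — such that for every prime `ℓ ∤ v` the `ℓ`-adic block holds (`T0`, `Ti`, `Tγ`, the six
compatibilities, `σ̃`, (σ-a), (σ-b), one common prime, (2′)), in the binder names and order of G10 `exists_iso_redHom_comp_eq_relFrobenius`.
[cite: Shimura1998, §11.1 Prop. 12, Prop. 14 (i); §18.6 proof of Thm. 18.6, p. 129] -/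
theorem exists_levelReductionData_pair_of_goodReductionAt
    (hHR : ∀ {k : Type} [Field k] [NumberField k] {A₀ B₀ : AbelianVariety k} {v : HeightOneSpectrum (𝓞 k)}
      (R : A₀.GoodReductionAt v) (S : B₀.GoodReductionAt v), HomReduction.nonempty_homReduction R S)
    (hS5c : ∀ {F₀ k : Type} [Field F₀] [NumberField F₀] [Field k] [NumberField k] [Algebra F₀ k]
      {v : HeightOneSpectrum (𝓞 k)} {ι : Type} {A : ι → AbelianVariety k}
      (R : ∀ i, (A i).GoodReductionAt v) (H : ∀ i j, HomReduction (R i) (R j)) (a : ι)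
      (γ : k ≃ₐ[F₀] k) (hγ : IsArithFrobAt (𝓞 F₀) γ v.asIdeal) (p n : ℕ) [ExpChar v.asIdeal.ResidueField p]
      (hq : Nat.card (𝓞 F₀ ⧸ v.asIdeal.under (𝓞 F₀)) = p ^ n)
      (Hγ : ∀ i, HomReduction (R i) ((R a).conjFrob γ hγ p n hq))
      (Hγ' : ∀ i, HomReduction ((R a).conjFrob γ hγ p n hq) (R i)) (ℓ : ℕ) [Fact ℓ.Prime],
      HomReduction.exists_isTateCompatible_family_conjFrob R H a γ hγ p n hq Hγ Hγ' ℓ)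
    {F₀ L : Type} [Field F₀] [NumberField F₀] [Field L] [NumberField L] [Algebra F₀ L]
    {A₀ Aᵢ : AbelianVariety L} {v : HeightOneSpectrum (𝓞 L)}
    (γ : L ≃ₐ[F₀] L) (hγ : IsArithFrobAt (𝓞 F₀) γ v.asIdeal) (p n : ℕ) [ExpChar v.asIdeal.ResidueField p]
    (hq : Nat.card (𝓞 F₀ ⧸ v.asIdeal.under (𝓞 F₀)) = p ^ n)
    (R : A₀.GoodReductionAt v) (Rᵢ : Aᵢ.GoodReductionAt v) :
    ∃ (H0i : HomReduction R Rᵢ) (Hi0 : HomReduction Rᵢ R)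
      (Hiγ : HomReduction Rᵢ (R.conjFrob γ hγ p n hq)) (Hγi : HomReduction (R.conjFrob γ hγ p n hq) Rᵢ)
      (H0γ : HomReduction R (R.conjFrob γ hγ p n hq)) (Hγ0 : HomReduction (R.conjFrob γ hγ p n hq) R),
      ∀ (ℓ : ℕ) [Fact ℓ.Prime] (hℓv : (ℓ : 𝓞 L) ∉ v.asIdeal),
      ∃ (T0 : R.TateSpecialisation ℓ) (Ti : Rᵢ.TateSpecialisation ℓ) (Tγ : (R.conjFrob γ hγ p n hq).TateSpecialisation ℓ)
        (_h0i : H0i.IsTateCompatible T0 Ti) (_hi0 : Hi0.IsTateCompatible Ti T0)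
        (_hiγT : Hiγ.IsTateCompatible Ti Tγ) (_hγiT : Hγi.IsTateCompatible Tγ Ti)
        (_h0γ : H0γ.IsTateCompatible T0 Tγ) (_hγ0 : Hγ0.IsTateCompatible Tγ T0)
        (σ' : AlgebraicClosure L ≃+* AlgebraicClosure L)
        -- (σ-a) `σ̃` extends `γ`
        (hσa : ∀ x : L, σ' (algebraMap L (AlgebraicClosure L) x) = algebraMap L (AlgebraicClosure L) (γ.toRingEquiv x)),
        -- (σ-b) `σ̃` is the `q`-th power map on the `ℓ`-power roots of unity
        (∀ (m : ℕ) (ζ : AlgebraicClosure L), ζ ^ (ℓ ^ m) = 1 → σ' ζ = ζ ^ (p ^ n)) ∧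
        -- one common prime
        T0.prime = Ti.prime ∧ Tγ.prime = T0.prime ∧
        -- (2′) the GEOMETRIC torsion clause «(x^σ̃)~ = π(x̃)» on A₀[ℓᵐ](K̄), the conjugate point read through (A^γ) ⊗ K̄ ≅ (A ⊗ K̄)^σ̃
        (∀ (m : ℕ) (x : A₀.geomTorsion (ℓ ^ m : ℕ)) (x' : (A₀.conjugate γ.toRingEquiv).geomTorsion (ℓ ^ m : ℕ)),
          Additive.toMul (x' : (A₀.conjugate γ.toRingEquiv).geomPoints) =
            ((A₀.conjugate γ.toRingEquiv).pointsMulEquiv (AlgebraicClosure L)).symm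
              (AlgPoints.map (conjugateBaseChangeAlongIso γ.toRingEquiv σ' hσa A₀).inv.hom.hom.hom
                ((A₀.baseChange (AlgebraicClosure L)).conjPoints σ'
                  (A₀.pointsMulEquiv (AlgebraicClosure L) (Additive.toMul (x : A₀.geomPoints))))) →
          (Tγ.reductionTorsionEquiv hℓv m x' : (R.conjFrob γ hγ p n hq).reduction.geomPoints) =
            Hom.geomPointsMap (R.reduction.relFrobenius p n)
              (T0.reductionTorsionEquiv hℓv m x : R.reduction.geomPoints)) := by
  classical
  obtain ⟨Hiγ, Hγi, H0γ, Hγ0, h⟩ := exists_levelReductionData_pair_of_homReduction hHR hS5c γ hγ p n hq R Rᵢ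
    (Classical.choice (hHR R Rᵢ)) (Classical.choice (hHR Rᵢ R))
  exact ⟨_, _, Hiγ, Hγi, H0γ, Hγ0, h⟩

/-- **Shimura's prime `𝔓` with the PRODUCED reduction data (`FactRH′` edition; FactGR out, F-HR only at the conjFrob pairs).**  From
`hRH` (= the line's single reduction binder `FactRH′` verbatim — B-p07's THEOREM `exists_finite_forall_exists_goodReductionAt_homReduction`,
Néron models away from finitely many places: good-reduction data AND in-family pair data PRODUCED outside a finite set), `hHR` (row II-1-Oa,
used only at the `2·|ι|` pairs against the constructed conjFrob datum of `A a`) and `hS5c`: for `g ∈ Gal(L/F)`, a finite family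
`A : ι → AbelianVariety L`, an index `a`, a finite set `S` and `M ≠ 0` — the conclusion of `exists_frobeniusPrime_levelReductionData`
character for character (a degree-one Frobenius prime `v ∉ S` away from `M`, `[ExpChar κ(v) p]`, `hγ`, `hq`, unramified, uniqueness,
`(d) ∉ v` for `d ∣ M`, good reduction of every member, `R`, `H`, `Hγ`, `Hγ'`, and for every prime `ℓ ∤ v` the F-S5c block at
`(γ, n) := (g, 1)`).  Proof: Čebotarev (G5) outside `S ∪ S_RH`; `R`, `H` := the produced data at `v`; `Hγ`, `Hγ'` := `hHR`; then `hS5c`.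
[cite: Shimura1998, §18.6 proof of Thm. 18.6, pp. 128–129; §11.1 Prop. 12, Prop. 14 (i)] -/
theorem exists_frobeniusPrime_levelReductionData_of_produced
    (hRH : ∀ {k : Type} [Field k] [NumberField k] {J : Type} [Finite J] (A : J → AbelianVariety k),
      ∃ S : Set (IsDedekindDomain.HeightOneSpectrum (𝓞 k)), S.Finite ∧ ∀ v ∉ S, ∃ R : ∀ i, (A i).GoodReductionAt v,
        ∀ i j, Nonempty (AbelianVariety.GoodReductionAt.HomReduction (R i) (R j)))
    (hHR : ∀ {k : Type} [Field k] [NumberField k] {A₀ B₀ : AbelianVariety k} {v : HeightOneSpectrum (𝓞 k)}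
      (R : A₀.GoodReductionAt v) (S : B₀.GoodReductionAt v), HomReduction.nonempty_homReduction R S)
    (hS5c : ∀ {F₀ k : Type} [Field F₀] [NumberField F₀] [Field k] [NumberField k] [Algebra F₀ k]
      {v : HeightOneSpectrum (𝓞 k)} {ι : Type} {A : ι → AbelianVariety k}
      (R : ∀ i, (A i).GoodReductionAt v) (H : ∀ i j, HomReduction (R i) (R j)) (a : ι)
      (γ : k ≃ₐ[F₀] k) (hγ : IsArithFrobAt (𝓞 F₀) γ v.asIdeal) (p n : ℕ) [ExpChar v.asIdeal.ResidueField p]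
      (hq : Nat.card (𝓞 F₀ ⧸ v.asIdeal.under (𝓞 F₀)) = p ^ n)
      (Hγ : ∀ i, HomReduction (R i) ((R a).conjFrob γ hγ p n hq))
      (Hγ' : ∀ i, HomReduction ((R a).conjFrob γ hγ p n hq) (R i)) (ℓ : ℕ) [Fact ℓ.Prime],
      HomReduction.exists_isTateCompatible_family_conjFrob R H a γ hγ p n hq Hγ Hγ' ℓ)
    {F L : Type} [Field F] [NumberField F] [Field L] [NumberField L]
    [Algebra F L] [IsGalois F L] (g : L ≃ₐ[F] L) {ι : Type} [Finite ι] (A : ι → AbelianVariety L) (a : ι)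
    {S : Set (HeightOneSpectrum (𝓞 L))} (hS : S.Finite) {M : ℕ} (hM : M ≠ 0) :
    ∃ (v : HeightOneSpectrum (𝓞 L)) (p : ℕ) (_ : ExpChar v.asIdeal.ResidueField p)
      (hγ : IsArithFrobAt (𝓞 F) g v.asIdeal) (hq : Nat.card (𝓞 F ⧸ v.asIdeal.under (𝓞 F)) = p ^ 1),
      v ∉ S ∧ p.Prime ∧ ¬ p ∣ M ∧ (p : 𝓞 L) ∈ v.asIdeal ∧ (M : 𝓞 L) ∉ v.asIdeal ∧
      (∀ d : ℕ, d ∣ M → (d : 𝓞 L) ∉ v.asIdeal) ∧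
      Algebra.IsUnramifiedIn (𝓞 L) (v.asIdeal.under (𝓞 F)) ∧
      (∀ φ : L ≃ₐ[F] L, IsArithFrobAt (𝓞 F) φ v.asIdeal → φ = g) ∧
      (∀ i, HasGoodReductionAt (A i).X (A i).dim v) ∧
      ∃ (R : ∀ i, (A i).GoodReductionAt v) (H : ∀ i j, HomReduction (R i) (R j))
        (Hγ : ∀ i, HomReduction (R i) ((R a).conjFrob g hγ p 1 hq))
        (Hγ' : ∀ i, HomReduction ((R a).conjFrob g hγ p 1 hq) (R i)),
        ∀ (ℓ : ℕ) [Fact ℓ.Prime] (hℓv : (ℓ : 𝓞 L) ∉ v.asIdeal),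
        ∃ (T : ∀ i, (R i).TateSpecialisation ℓ) (Tγ : ((R a).conjFrob g hγ p 1 hq).TateSpecialisation ℓ)
        (σ' : AlgebraicClosure L ≃+* AlgebraicClosure L)
        -- (σ-a) `σ̃` extends `γ`
        (hσa : ∀ x : L, σ' (algebraMap L (AlgebraicClosure L) x) = algebraMap L (AlgebraicClosure L) (g.toRingEquiv x)),
        -- (σ-b) `σ̃` is the `q`-th power map on the `ℓ`-power roots of unity
        (∀ (m : ℕ) (ζ : AlgebraicClosure L), ζ ^ (ℓ ^ m) = 1 → σ' ζ = ζ ^ (p ^ 1)) ∧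
        -- (1) one common prime; Tate compatibility of all pair data [§11.1 Prop. 14 (i)]
        (∀ i j, (T i).prime = (T j).prime) ∧ (∀ i, Tγ.prime = (T i).prime) ∧
        (∀ i j, (H i j).IsTateCompatible (T i) (T j)) ∧
        (∀ i, (Hγ i).IsTateCompatible (T i) Tγ) ∧ (∀ i, (Hγ' i).IsTateCompatible Tγ (T i)) ∧
        -- (2′) the GEOMETRIC torsion clause «(x^σ̃)~ = π(x̃)» on (A a)[ℓᵐ](K̄), the conjugate point read through (A^γ) ⊗ K̄ ≅ (A ⊗ K̄)^σ̃
        (∀ (m : ℕ) (x : (A a).geomTorsion (ℓ ^ m : ℕ)) (x' : ((A a).conjugate g.toRingEquiv).geomTorsion (ℓ ^ m : ℕ)),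
          Additive.toMul (x' : ((A a).conjugate g.toRingEquiv).geomPoints) =
            (((A a).conjugate g.toRingEquiv).pointsMulEquiv (AlgebraicClosure L)).symm
              (AlgPoints.map (conjugateBaseChangeAlongIso g.toRingEquiv σ' hσa (A a)).inv.hom.hom.hom
                (((A a).baseChange (AlgebraicClosure L)).conjPoints σ'
                  ((A a).pointsMulEquiv (AlgebraicClosure L) (Additive.toMul (x : (A a).geomPoints))))) →
          (Tγ.reductionTorsionEquiv hℓv m x' : ((R a).conjFrob g hγ p 1 hq).reduction.geomPoints) =
            Hom.geomPointsMap ((R a).reduction.relFrobenius p 1)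
              ((T a).reductionTorsionEquiv hℓv m x : (R a).reduction.geomPoints)) := by
  classical
  obtain ⟨S', hS'f, hprod⟩ := hRH A
  obtain ⟨v, p, hvS, hp, hpM, hpv, hMv, hexp, hfrob, hq, hunr, huniq⟩ :=
    exists_frobeniusPrime g (hS.union hS'f) hM
  haveI := hexp
  obtain ⟨R, hH⟩ := hprod v fun h => hvS (Or.inr h)
  let H : ∀ i j, HomReduction (R i) (R j) := fun i j => Classical.choice (hH i j)
  let Hγ : ∀ i, HomReduction (R i) ((R a).conjFrob g hfrob p 1 hq) :=
    fun i => Classical.choice (hHR (R i) ((R a).conjFrob g hfrob p 1 hq))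
  let Hγ' : ∀ i, HomReduction ((R a).conjFrob g hfrob p 1 hq) (R i) :=
    fun i => Classical.choice (hHR ((R a).conjFrob g hfrob p 1 hq) (R i))
  refine ⟨v, p, hexp, hfrob, hq, fun h => hvS (Or.inl h), hp, hpM, hpv, hMv, ?_, hunr, huniq,
    fun i => (R i).hasGoodReductionAt, R, H, Hγ, Hγ', fun ℓ _ hℓv => hS5c R H a g hfrob p 1 hq Hγ Hγ' ℓ hℓv⟩
  -- `d ∣ M` and `(M) ∉ v` give `(d) ∉ v`
  intro d hdM hdv
  obtain ⟨c, hc⟩ := hdM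
  exact hMv (by rw [hc, Nat.cast_mul]; exact v.asIdeal.mul_mem_right _ hdv)

end Literature.NumberTheory.ComplexMultiplication
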